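import Literature.Geometry.Riemannian.RiemannianCoveringVolume
import HarnessLib

/-!
# Budget transfer, measure part: injective local isometries preserve the Riemannian measure

Support file (everything proved; no definitions, no named facts) for the support item
`BudgetTransfer` of route WeylBudget (item stmt-SmoothPoincare4-3208). For a `C^∞` map
`F : M₁ → M₂` between Riemannian manifolds of the same dimension which is injective, a local
diffeomorphism at every point and isometric (`g₂(dF v, dF w) = g₁(v, w)`):

* `measurableEmbedding_of_localIsometry` — `F` is an open embedding, hence a measurable embedding;
* `comap_riemannianMeasure_of_localIsometry` — **`F^* dV_{g₂} = dV_{g₁}`**: the pullback of the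
  Riemannian measure of `M₂` is the Riemannian measure of `M₁` (locally, `F` preserves the length
  distance, `RiemannianCovering.exists_nhds_edist_comp_eq`, hence the Euclidean-normalised Hausdorff
  measures of small sets, `RiemannianCovering.riemannianMeasure_image_eq_of_subset`, Federer 1969,
  §2.10.11; globalised over a countable cover by such neighbourhoods, `Measure.ext_of_biUnion_eq_univ`);
* `map_riemannianMeasure_of_localIsometry` (`F_* dV_{g₁} = dV_{g₂}|_{F(M₁)}`) and
  `setLIntegral_range_of_localIsometry` (`∫_{F(M₁)} f dV_{g₂} = ∫_{M₁} f ∘ F dV_{g₁}`) — the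
  change of variables along an isometric open embedding (Lee 2018, Prop. 2.51; Chavel 2006, §III.3).

## References

* H. Federer, *Geometric Measure Theory* (1969), §2.10.11, §3.2.46. [Federer1969]
* J. M. Lee, *Introduction to Riemannian Manifolds*, 2nd ed. (2018), Prop. 2.51. [Lee2018]
* I. Chavel, *Riemannian Geometry: A Modern Introduction*, 2nd ed. (2006), §III.3. [Chavel2006]
-/

noncomputable section

-- the registered namespace `Summit.SmoothPoincare4.SmoothPoincare4.Theorems` repeats a component
set_option linter.dupNamespace false

open Bundle Set Function Filter MeasureTheory Measure Manifold Module Topology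
open scoped Manifold ContDiff Topology ENNReal NNReal

namespace Summit.SmoothPoincare4.SmoothPoincare4.Theorems

namespace BudgetTransfer

open Literature.Geometry.Lorentzian Literature.Geometry.Lorentzian.PseudoRiemannianMetric
open Literature.Geometry.Riemannian Literature.Geometry.Riemannian.RiemannianCovering

variable {E₁ : Type*} [NormedAddCommGroup E₁] [NormedSpace ℝ E₁] [FiniteDimensional ℝ E₁]
  {H₁ : Type*} [TopologicalSpace H₁] {I₁ : ModelWithCorners ℝ E₁ H₁}
  {M₁ : Type*} [TopologicalSpace M₁] [ChartedSpace H₁ M₁] [IsManifold I₁ ∞ M₁]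
  {E₂ : Type*} [NormedAddCommGroup E₂] [NormedSpace ℝ E₂] [FiniteDimensional ℝ E₂]
  {H₂ : Type*} [TopologicalSpace H₂] {I₂ : ModelWithCorners ℝ E₂ H₂}
  {M₂ : Type*} [TopologicalSpace M₂] [ChartedSpace H₂ M₂] [IsManifold I₂ ∞ M₂]
  {g₁ : PseudoRiemannianMetric I₁ ∞ E₁ (TangentSpace I₁ : M₁ → Type _)}
  {g₂ : PseudoRiemannianMetric I₂ ∞ E₂ (TangentSpace I₂ : M₂ → Type _)}
  {F : M₁ → M₂}

omit [FiniteDimensional ℝ E₁] [IsManifold I₁ ∞ M₁] [FiniteDimensional ℝ E₂] [IsManifold I₂ ∞ M₂] in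
/-- An injective local diffeomorphism is an open embedding. [folklore] -/
theorem isOpenEmbedding_of_isLocalDiffeomorph (hloc : IsLocalDiffeomorph I₁ I₂ ∞ F)
    (hinj : Injective F) : IsOpenEmbedding F :=
  IsOpenEmbedding.of_continuous_injective_isOpenMap hloc.isLocalHomeomorph.continuous hinj
    hloc.isOpenMap

variable [T3Space M₁] [MeasurableSpace M₁] [BorelSpace M₁] [T3Space M₂] [MeasurableSpace M₂]
  [BorelSpace M₂]

omit [FiniteDimensional ℝ E₁] [IsManifold I₁ ∞ M₁] [FiniteDimensional ℝ E₂] [IsManifold I₂ ∞ M₂]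
  [T3Space M₁] [T3Space M₂] in
/-- An injective local diffeomorphism is a measurable embedding (Borel structures). [folklore] -/
theorem measurableEmbedding_of_localIsometry (hloc : IsLocalDiffeomorph I₁ I₂ ∞ F)
    (hinj : Injective F) : MeasurableEmbedding F :=
  (isOpenEmbedding_of_isLocalDiffeomorph hloc hinj).measurableEmbedding

variable [SecondCountableTopology M₁]

/-- **An injective local isometry pulls the Riemannian measure back to the Riemannian measure**:
`F^*(dV_{g₂}) = dV_{g₁}` for a `C^∞` injective `F : M₁ → M₂`, a local diffeomorphism at every
point, with `g₂(dF v, dF w) = g₁(v, w)` and `dim M₁ = dim M₂`. Every point of `M₁` has a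
neighbourhood on which `F` preserves the length distance
(`RiemannianCovering.exists_nhds_edist_comp_eq`, Lee 2018, proof of Thm. 6.23 / Prop. 2.51), so
`F` preserves the Euclidean-normalised Hausdorff measures of its subsets
(`RiemannianCovering.riemannianMeasure_image_eq_of_subset`, Federer 1969, §2.10.11); countably many
such neighbourhoods cover `M₁`, and two measures which agree on every measurable subset of each
member of a countable cover agree (`Measure.ext_of_biUnion_eq_univ`).
[cite: Federer1969, §2.10.11 and §3.2.46] [cite: Lee2018, Prop. 2.51] -/
theorem comap_riemannianMeasure_of_localIsometry (hg₁ : g₁.IsRiemannian) (hg₂ : g₂.IsRiemannian)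
    (hF : ContMDiff I₁ I₂ ∞ F) (hinj : Injective F) (hloc : IsLocalDiffeomorph I₁ I₂ ∞ F)
    (hiso : ∀ (x : M₁) (v w : TangentSpace I₁ x),
      g₂.val (F x) (mfderiv I₁ I₂ F x v) (mfderiv I₁ I₂ F x w) = g₁.val x v w)
    (hdim : finrank ℝ E₁ = finrank ℝ E₂) :
    Measure.comap F (riemannianMeasure (g₂.toContMDiffRiemannianMetric hg₂)) =
      riemannianMeasure (g₁.toContMDiffRiemannianMetric hg₁) := by
  set μ₁ := riemannianMeasure (g₁.toContMDiffRiemannianMetric hg₁) with hμ₁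
  set μ₂ := riemannianMeasure (g₂.toContMDiffRiemannianMetric hg₂) with hμ₂
  have hme : MeasurableEmbedding F := measurableEmbedding_of_localIsometry hloc hinj
  have hF1 : ContMDiff I₁ I₂ 1 F := hF.of_le (by exact_mod_cast (le_top : (1 : ℕ∞) ≤ ⊤))
  -- distance-preserving neighbourhoods
  choose U hUo hxU _ hUiso using fun x : M₁ ↦ exists_nhds_edist_comp_eq hg₁ hg₂ hF1 hiso (hloc x)
  obtain ⟨s, hsc, hsU⟩ := TopologicalSpace.countable_cover_nhds fun x ↦ (hUo x).mem_nhds (hxU x)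
  refine Measure.ext_of_biUnion_eq_univ hsc hsU fun x _ ↦ ?_
  ext A hA
  rw [Measure.restrict_apply hA, Measure.restrict_apply hA, hme.comap_apply]
  exact riemannianMeasure_image_eq_of_subset hg₁ hg₂ (hUiso x) inter_subset_right hdim

/-- **`F_*(dV_{g₁}) = dV_{g₂}|_{F(M₁)}`** for an injective `C^∞` local isometry `F` between
manifolds of the same dimension. [cite: Lee2018, Prop. 2.51] -/
theorem map_riemannianMeasure_of_localIsometry (hg₁ : g₁.IsRiemannian) (hg₂ : g₂.IsRiemannian)
    (hF : ContMDiff I₁ I₂ ∞ F) (hinj : Injective F) (hloc : IsLocalDiffeomorph I₁ I₂ ∞ F)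
    (hiso : ∀ (x : M₁) (v w : TangentSpace I₁ x),
      g₂.val (F x) (mfderiv I₁ I₂ F x v) (mfderiv I₁ I₂ F x w) = g₁.val x v w)
    (hdim : finrank ℝ E₁ = finrank ℝ E₂) :
    Measure.map F (riemannianMeasure (g₁.toContMDiffRiemannianMetric hg₁)) =
      (riemannianMeasure (g₂.toContMDiffRiemannianMetric hg₂)).restrict (range F) := by
  rw [← comap_riemannianMeasure_of_localIsometry hg₁ hg₂ hF hinj hloc hiso hdim,
    (measurableEmbedding_of_localIsometry hloc hinj).map_comap]

/-- **Change of variables along an isometric open embedding**: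
`∫_{F(M₁)} f dV_{g₂} = ∫_{M₁} (f ∘ F) dV_{g₁}` for every `f : M₂ → [0, ∞]` (no measurability
needed, `F` being a measurable embedding). [cite: Lee2018, Prop. 2.51] [cite: Chavel2006, §III.3] -/
theorem setLIntegral_range_of_localIsometry (hg₁ : g₁.IsRiemannian) (hg₂ : g₂.IsRiemannian)
    (hF : ContMDiff I₁ I₂ ∞ F) (hinj : Injective F) (hloc : IsLocalDiffeomorph I₁ I₂ ∞ F)
    (hiso : ∀ (x : M₁) (v w : TangentSpace I₁ x),
      g₂.val (F x) (mfderiv I₁ I₂ F x v) (mfderiv I₁ I₂ F x w) = g₁.val x v w)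
    (hdim : finrank ℝ E₁ = finrank ℝ E₂) (f : M₂ → ℝ≥0∞) :
    ∫⁻ y in range F, f y ∂(riemannianMeasure (g₂.toContMDiffRiemannianMetric hg₂)) =
      ∫⁻ x, f (F x) ∂(riemannianMeasure (g₁.toContMDiffRiemannianMetric hg₁)) := by
  rw [← map_riemannianMeasure_of_localIsometry hg₁ hg₂ hF hinj hloc hiso hdim,
    (measurableEmbedding_of_localIsometry hloc hinj).lintegral_map]

end BudgetTransfer

end Summit.SmoothPoincare4.SmoothPoincare4.Theorems

end
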